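import Literature.AlgebraicGeometry.AbelianVarieties.MarkmanKernelTransformPullbackModel
import Literature.AlgebraicGeometry.AbelianVarieties.MarkmanPhiTilde
import HarnessLib

/-!
# Markman's `Φ` followed by the descent twist, `Φ_T := (– ⊗ D′_s)⁺ ∘ Φ`, and the `e₂`-isomorphism
# `ι(Φ_T X) ≅ Q(q^*E•)` for every `X ≅ ([Θ ⊠ Θ] ⊗)⁺((π₁ × π₂)^*F₀[0])` in `D⁺(Mod 𝒪_{A×A})`

Layer `Literature/AlgebraicGeometry/AbelianVarieties`; sequel to `MarkmanKernelTransformPullbackModel` (the pulled-back model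
`(– ⊗ D′_s)⁺(Φ̃⁺(((π₁ × π₂)^*F₀)[0])) ≅ Q⁺(q^*E•)`, CONDITIONAL on [GS] `Grothendieck_higherDirectImage_coh` and [SP]
`ThomasonTrobaugh_vbModel_of_boundedCoh`) and `MarkmanPhiTilde` (`Φ̃ ≅ Φ ∘ ([Θ ⊠ Θ] ⊗)`). For Markman's secant data
(`A`, `Θ` ample with `K(Θ) = 0`, `n ≠ 0`, `G₁, G₂ ≤ A[n]`) this file PROVES (0 new facts; [GS], [SP] as hypotheses; no instances):

* §1 **`markmanPhiDescentTwistPlus A hΘ hK s j := markmanPhiPlus A hΘ hK ⋙ (– ⊗ D′_s)⁺`**, a functor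
  `D⁺(Mod 𝒪_{A×A}) ⥤ D⁺(Mod 𝒪_{A×Â})` (placement «P1» of the cell's wiring: ONE functor carrying the twist), its unfolding and its
  `CommShift ℤ` structure (a `def`, bind with `letI`);
* §2 **`markmanPhiDescentTwist_pullback_vbModel_of_iso`** — for `F₀` coherent on `A/G₁ × A/G₂` and ANY object `X` of
  `D⁺(Mod 𝒪_{A×A})` given with an isomorphism `X ≅ ([Θ ⊠ Θ] ⊗)⁺(((π₁ × π₂)^*F₀)[0])`: there is a bounded complex `E•` of finite
  locally free `𝒪_Y`-modules with **`ι(Φ_T X) ≅ Q(q^*E•)`** in `D(Mod 𝒪_{A×Â})` (`ι = DerivedCategory.Plus.ι`, `q : A × Â → Y` the secant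
  quotient isogeny, `q^*E•` termwise). Proof: `Φ(X) ≅ Φ(([Θ ⊠ Θ] ⊗)⁺ F[0]) ≅ Φ̃(F[0])` (`markmanPhiTildePlusIso`), then the pulled-back
  model, then `ι ∘ Q⁺ = Q` on underlying complexes.

The isomorphism `X ≅ ([Θ ⊠ Θ] ⊗)⁺(((π₁ × π₂)^*F₀)[0])` is a HYPOTHESIS (for the box of two strictly perfect resolutions it is the
external-product-of-resolutions comparison, typed separately). A research route conditional on HC_CM, not a corollary — nothing in
this file refers to it.

## References

* E. Markman, arXiv:2502.03415 (2025), §9.3 p. 70 L47 (`Φ̃ := Φ ∘ ([Θ ⊠ Θ] ⊗)`), Remark 9.3.7 (p. 73). [Markman2025SecantWeil]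
* C. A. Weibel, *An introduction to homological algebra* (1994), 10.5.2 (exact functors on `D⁺`). [Weibel1994]
* S. Mukai, Nagoya Math. J. 81 (1981), §1 (1.1), (1.4). [Mukai1981]
-/

noncomputable section

-- `TopCat.Presheaf`/`Scheme.Modules` are not reducible (as in Mathlib's `AlgebraicGeometry/Modules/Sheaf.lean`).
set_option backward.isDefEq.respectTransparency false

open CategoryTheory CategoryTheory.Limits AlgebraicGeometry MonoidalCategory CartesianMonoidalCategory
open AlgebraicGeometry.Scheme.Modules

universe v₁ v₂ v₃ v₄ v₅

namespace Literature.AlgebraicGeometry.AbelianVarieties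

open Literature.AlgebraicGeometry.Motives Literature.AlgebraicGeometry.Modules Literature.AlgebraicGeometry.Markman2025
open Literature.AlgebraicGeometry.Morphisms Literature.AlgebraicGeometry.KTheory

variable (A : AbelianVariety ℂ) {Θ : CartierDivisor A.X.left} (hΘ : Θ.IsAmple) (hK : A.KTheta Θ = ⊥)

/-! ### §1 `Φ_T := (– ⊗ D′_s)⁺ ∘ Φ` -/

section Functor

/-- `D′_s ⊗ –` is left exact (a line bundle). [cite: StacksProject, Tag 0B8M] -/
theorem preservesFiniteLimits_tensor_descentTwist (s j : ℕ) :
    PreservesFiniteLimits ((tensorBifunctor (A.X ⊗ (A.dualOf Θ hΘ).X).left).obj (descentTwist A hΘ hK s j)) :=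
  (isInvertibleModule_of_hasRank_one (isFiniteLocallyFree_descentTwist A hΘ hK s j)
    (hasRank_descentTwist A hΘ hK s j)).preservesFiniteLimits

/-- `D′_s ⊗ –` is right exact. [cite: StacksProject, Tag 0B8M] -/
theorem preservesFiniteColimits_tensor_descentTwist (s j : ℕ) :
    PreservesFiniteColimits ((tensorBifunctor (A.X ⊗ (A.dualOf Θ hΘ).X).left).obj (descentTwist A hΘ hK s j)) :=
  (isInvertibleModule_of_hasRank_one (isFiniteLocallyFree_descentTwist A hΘ hK s j)
    (hasRank_descentTwist A hΘ hK s j)).preservesFiniteColimits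

variable [HasDerivedCategory.{v₁} (A.X ⊗ A.X).left.Modules]
  [HasDerivedCategory.{v₂} ((A.X ⊗ A.X) ⊗ (A.dualOf Θ hΘ).X).left.Modules]
  [HasDerivedCategory.{v₃} (A.X ⊗ (A.dualOf Θ hΘ).X).left.Modules]

/-- **`Φ_T := Φ ⋙ (– ⊗ D′_s)⁺ : D⁺(Mod 𝒪_{A×A}) ⥤ D⁺(Mod 𝒪_{A×Â})`** — Markman's `Φ = (id × Ψ_{𝒫⁻¹}) ∘ μ^*` followed by the exact
functor of tensoring with the descent twist `D′_s` (the ONE functor of the cell's placement «P1»; fullness NOT asserted).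
[cite: Markman2025SecantWeil, §9.3 Remark 9.3.7 (p. 73)] [cite: Weibel1994, 10.5.2] -/
def markmanPhiDescentTwistPlus (s j : ℕ) :
    DerivedCategory.Plus (A.X ⊗ A.X).left.Modules ⥤ DerivedCategory.Plus (A.X ⊗ (A.dualOf Θ hΘ).X).left.Modules :=
  haveI := additive_tensorBifunctor_obj (descentTwist A hΘ hK s j)
  haveI := preservesFiniteLimits_tensor_descentTwist A hΘ hK s j
  haveI := preservesFiniteColimits_tensor_descentTwist A hΘ hK s j
  markmanPhiPlus A hΘ hK ⋙ ((tensorBifunctor (A.X ⊗ (A.dualOf Θ hΘ).X).left).obj (descentTwist A hΘ hK s j)).mapDerivedCategoryPlus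

/-- Unfolding of `markmanPhiDescentTwistPlus`. [cite: Markman2025SecantWeil, §9.3 Remark 9.3.7 (p. 73)] -/
theorem markmanPhiDescentTwistPlus_def (s j : ℕ) :
    markmanPhiDescentTwistPlus A hΘ hK s j =
      (haveI := additive_tensorBifunctor_obj (descentTwist A hΘ hK s j)
       haveI := preservesFiniteLimits_tensor_descentTwist A hΘ hK s j
       haveI := preservesFiniteColimits_tensor_descentTwist A hΘ hK s j
       markmanPhiPlus A hΘ hK ⋙
        ((tensorBifunctor (A.X ⊗ (A.dualOf Θ hΘ).X).left).obj (descentTwist A hΘ hK s j)).mapDerivedCategoryPlus) := rfl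

/-- `Φ_T` commutes with the shifts (composite of two shift-commuting functors). A `def`, not an instance (bind with `letI`).
[cite: Weibel1994, 10.5.2] -/
@[implicit_reducible]
def commShiftMarkmanPhiDescentTwistPlus (s j : ℕ) : (markmanPhiDescentTwistPlus A hΘ hK s j).CommShift ℤ := by
  haveI := additive_tensorBifunctor_obj (descentTwist A hΘ hK s j)
  haveI := preservesFiniteLimits_tensor_descentTwist A hΘ hK s j
  haveI := preservesFiniteColimits_tensor_descentTwist A hΘ hK s j
  letI := commShiftMarkmanPhiPlus A hΘ hK
  letI := ((tensorBifunctor (A.X ⊗ (A.dualOf Θ hΘ).X).left).obj (descentTwist A hΘ hK s j)).commShiftMapDerivedCategoryPlus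
    (C := (A.X ⊗ (A.dualOf Θ hΘ).X).left.Modules) (D := (A.X ⊗ (A.dualOf Θ hΘ).X).left.Modules)
  exact (inferInstance : (markmanPhiPlus A hΘ hK ⋙
    ((tensorBifunctor (A.X ⊗ (A.dualOf Θ hΘ).X).left).obj (descentTwist A hΘ hK s j)).mapDerivedCategoryPlus).CommShift ℤ)

end Functor

/-! ### §2 `ι(Φ_T X) ≅ Q(q^*E•)` for `X ≅ ([Θ ⊠ Θ] ⊗)⁺(((π₁ × π₂)^*F₀)[0])` -/

section Model

variable {n : ℕ} (hn : n ≠ 0) (G₁ G₂ : Subgroup (A.Points ℂ)) (hG₁ : G₁ ≤ A.torsionPoints ℂ n) (hG₂ : G₂ ≤ A.torsionPoints ℂ n)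
  [HasDerivedCategory.{v₁} (A.X ⊗ A.X).left.Modules]
  [HasDerivedCategory.{v₂} ((A.X ⊗ A.X) ⊗ (A.dualOf Θ hΘ).X).left.Modules]
  [HasDerivedCategory.{v₃} (A.X ⊗ (A.dualOf Θ hΘ).X).left.Modules]
  [HasDerivedCategory.{v₄} ((secantQuotient A hΘ G₁ G₂ hn hG₁ hG₂).X ⊗ A.X).left.Modules]
  [HasDerivedCategory.{v₅} (secantQuotient A hΘ G₁ G₂ hn hG₁ hG₂).X.left.Modules]

/-- **`e₂` from a `Θ ⊠ Θ`-presentation of the input** — for `F₀` coherent on `A/G₁ × A/G₂`, under [GS]+[SP] and the exponent ∕ order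
hypotheses of the kernel descent: every `X ∈ D⁺(Mod 𝒪_{A×A})` with `X ≅ ([Θ ⊠ Θ] ⊗)⁺(((π₁ × π₂)^*F₀)[0])` satisfies
**`ι(Φ_T X) ≅ Q(q^*E•)`** in `D(Mod 𝒪_{A×Â})` for some bounded complex `E•` of finite locally free `𝒪_Y`-modules (`q^*E•` termwise along the
secant quotient isogeny `q : A × Â → Y`). Proof: `Φ(X) ≅ Φ(([Θ ⊠ Θ] ⊗)⁺F[0]) ≅ Φ̃(F[0])` (`markmanPhiTildePlusIso`), `(– ⊗ D′_s)⁺` of it, the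
pulled-back model `markmanKernelTransform_pullback_vbModel`, and `ι(Q⁺ K) = Q(K)`.
[cite: Markman2025SecantWeil, §9.3 p. 70 L47 and Remark 9.3.7 (p. 73)] [cite: Weibel1994, 10.5.2] -/
theorem markmanPhiDescentTwist_pullback_vbModel_of_iso (hGS : Grothendieck_higherDirectImage_coh.{0, v₄, v₅})
    (hSP : ThomasonTrobaugh_vbModel_of_boundedCoh.{v₅}) {s j m₁ m₂ : ℕ} (hj : 2 * j + 1 = n)
    (hm₁ : n * m₁ = 2 * s + j + 1) (hm₂ : n * m₂ + j = 2 * s) (hc₁ : Nat.card G₁ = n) (hc₂ : Nat.card G₂ = n)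
    (F₀ : ((A.torsionQuot hn G₁ hG₁).X ⊗ (A.torsionQuot hn G₂ hG₂).X).left.Modules) (hF₀ : Coh F₀)
    (X : DerivedCategory.Plus (A.X ⊗ A.X).left.Modules)
    (e : X ≅ (haveI := additive_tensor_thetaBox A (Θ := Θ)
      haveI := preservesFiniteLimits_tensor_thetaBox A (Θ := Θ)
      haveI := preservesFiniteColimits_tensor_thetaBox A (Θ := Θ)
      ((tensorBifunctor (A.X ⊗ A.X).left).obj (thetaBox A Θ)).mapDerivedCategoryPlus).obj
        ((DerivedCategory.Plus.singleFunctor _ 0).obj ((Scheme.Modules.pullback (quotientPairMap A hn G₁ G₂ hG₁ hG₂)).obj F₀))) :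
    ∃ (K : CochainComplex (secantQuotient A hΘ G₁ G₂ hn hG₁ hG₂).X.left.Modules ℤ) (_ : IsBoundedVBComplex K),
      Nonempty (DerivedCategory.Plus.ι.obj ((markmanPhiDescentTwistPlus A hΘ hK s j).obj X) ≅
        DerivedCategory.Q.obj (((Scheme.Modules.pullback (secantQuotientSchemeMap A hΘ hn G₁ G₂ hG₁ hG₂)).mapHomologicalComplex
          (ComplexShape.up ℤ)).obj K)) := by
  obtain ⟨K, hKvb, n₀, hn₀, ⟨eK⟩⟩ :=
    markmanKernelTransform_pullback_vbModel A hΘ hK hn G₁ G₂ hG₁ hG₂ hGS hSP hj hm₁ hm₂ hc₁ hc₂ F₀ hF₀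
  haveI := additive_tensor_thetaBox A (Θ := Θ)
  haveI := preservesFiniteLimits_tensor_thetaBox A (Θ := Θ)
  haveI := preservesFiniteColimits_tensor_thetaBox A (Θ := Θ)
  haveI := additive_tensorBifunctor_obj (descentTwist A hΘ hK s j)
  haveI := preservesFiniteLimits_tensor_descentTwist A hΘ hK s j
  haveI := preservesFiniteColimits_tensor_descentTwist A hΘ hK s j
  let T := ((tensorBifunctor (A.X ⊗ (A.dualOf Θ hΘ).X).left).obj (descentTwist A hΘ hK s j)).mapDerivedCategoryPlus
  let F := (Scheme.Modules.pullback (quotientPairMap A hn G₁ G₂ hG₁ hG₂)).obj F₀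
  -- `Φ(X) ≅ Φ(([Θ ⊠ Θ] ⊗)⁺ F[0]) ≅ Φ̃(F[0])`
  let e₁ : (markmanPhiPlus A hΘ hK).obj X ≅ (markmanPhiTildePlus A hΘ hK).obj ((DerivedCategory.Plus.singleFunctor _ 0).obj F) :=
    (markmanPhiPlus A hΘ hK).mapIso e ≪≫ (markmanPhiTildePlusIso A hΘ hK).app _
  exact ⟨K, hKvb, ⟨DerivedCategory.Plus.ι.mapIso (T.mapIso e₁ ≪≫ eK)⟩⟩

end Model

end Literature.AlgebraicGeometry.AbelianVarieties

end
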